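import Summits.Ventures.PercRepro.SixFourResidueFourGenericAll
import Summits.Ventures.PercRepro.SixFourResidueBigPlane

/-!
# PercRepro — C-025 at `(6,4)`: the per-pair inequality of Theorem G as an integer table, `10 ≤ g ≤ 100` (p3, gen 11 — §21.13.3)

`PerPair4 g p m` (`SixFourResidueFourGenericA.lean`) is a rational inequality with denominators `5`, `3`, `g − m`,
`C(g,2)`; multiplied by `15·(g − m)·C(g,2) > 0` it is the integer inequality `PerPairN4 g p m`
(`perPair4_of_perPairN4`).  `perPairCheck4 g` decides it on every `3 ≤ p ≤ g − 3`, `2 ≤ m < p`; the checks for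
`10 ≤ g ≤ 100` are here (mine-2's `j4tail_crude`: the minimum of `T/(base + (6/5)Ξ)` is `0.0508` at `(g, p) = (11, 8)`,
rising with `g`; the seat's own exact re-check `mining/p3/perpair4.py`: 147,420 cells, 0 failures, the same minimum),
giving **Theorem G for `10 ≤ g ≤ 100`** (`J_four_nonneg_of_generic_of_table`, no bound on the planes); `g ≥ 101` is
§21.13.3's two-regime tail (`PerPairTail4`, open), and `GenericFour` / `GenericFourBig` (`SixFourResidueBigPlane.lean`)
follow from it (`genericFour_of_perPairTail4`, `genericFourBig_of_perPairTail4`).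
-/

namespace PercRepro.SixFour

/-- `15·F(g)` as an integer: `12·2^g + 6·S₃(g) − 24·C(g,4)`. -/
def FgN (g : ℕ) : ℤ := 12 * (2 ^ g : ℤ) + 6 * (S3 g : ℤ) - 24 * (g.choose 4 : ℤ)

/-- `15·bonus(m) = 6·δ(m) + 24·C(m,4)`. -/
def bonusN (m : ℕ) : ℤ := 6 * (delta m : ℤ) + 24 * (m.choose 4 : ℤ)

/-- `15·(g − m)·C(g,2)·L(g,p,m)`. -/
def LtermN4 (g p m : ℕ) : ℤ :=
  ((p - m : ℕ) : ℤ) * (FgN g * (m.choose 2 : ℤ) + (g.choose 2 : ℤ) * (bonusN m + 10 * (eps m : ℤ) * ((g - m).choose 2 : ℤ))) +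
    (g.choose 2 : ℤ) * ((g - m : ℕ) : ℤ) *
      ((15 * ((g : ℤ) - p) - 6) * (delta m : ℤ) - 24 * (m.choose 4 : ℤ) - 10 * (eps m : ℤ) * ((p - m).choose 2 : ℤ))

/-- `5·base(g,p) = (5(g − p) − 2)·δ(p) − 8·C(p,4)`. -/
def base4N (g p : ℕ) : ℤ := (5 * ((g : ℤ) - p) - 2) * (delta p : ℤ) - 8 * (p.choose 4 : ℤ)

/-- The per-pair inequality in `ℤ` (×`15·(g − m)·C(g,2)`):
`C(m,2)·(3·base4N + 18·Ξ)·(g − m)·C(g,2) ≤ C(p,2)·LtermN4`. -/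
def PerPairN4 (g p m : ℕ) : Prop :=
  (m.choose 2 : ℤ) * (3 * base4N g p + 18 * (xiCrude g p : ℤ)) * ((g - m : ℕ) : ℤ) * (g.choose 2 : ℤ) ≤
    (p.choose 2 : ℤ) * LtermN4 g p m

/-- `PerPairN4` is decidable. -/
instance (g p m : ℕ) : Decidable (PerPairN4 g p m) := by unfold PerPairN4; infer_instance

/-- `15·F(g) = FgN g` in `ℚ`. -/
theorem FgN_eq (g : ℕ) : (FgN g : ℚ) = 15 * Fg g := by
  unfold FgN Fg
  push_cast
  ring

/-- `15·bonus(m) = bonusN m` in `ℚ`. -/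
theorem bonusN_eq (m : ℕ) : (bonusN m : ℚ) = 15 * bonus m := by
  unfold bonusN bonus
  push_cast
  ring

/-- `15·(g − m)·C(g,2)·L(g,p,m) = LtermN4 g p m` for `m < g`, `2 ≤ g`. -/
theorem LtermN4_eq {g p m : ℕ} (hm : m < g) (hg : 2 ≤ g) :
    (LtermN4 g p m : ℚ) = 15 * ((g - m : ℕ) : ℚ) * (g.choose 2 : ℚ) * Lterm4 g p m := by
  have hD : ((g - m : ℕ) : ℚ) ≠ 0 := by
    have : 0 < g - m := by omega
    positivity
  have hC : (g.choose 2 : ℚ) ≠ 0 := by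
    have : 0 < g.choose 2 := Nat.choose_pos hg
    positivity
  have hy := price_identity4 (g := g) (m := m) hm
  have hF := Fg_eq_yP4 (g := g) hg
  unfold LtermN4
  push_cast
  rw [FgN_eq, bonusN_eq, hF]
  unfold Lterm4
  have hy' : yPrice4 g m = (yP4 g * (m.choose 2 : ℚ) + bonus m + 2 / 3 * ((eps m : ℚ) * ((g - m).choose 2 : ℚ))) /
      ((g - m : ℕ) : ℚ) := by
    rw [eq_div_iff hD]
    exact hy
  rw [hy']
  field_simp
  ring

/-- **Transfer**: the integer inequality gives the rational one. -/
theorem perPair4_of_perPairN4 {g p m : ℕ} (hm : m < g) (hg : 2 ≤ g) (h : PerPairN4 g p m) : PerPair4 g p m := by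
  unfold PerPairN4 at h
  unfold PerPair4
  have hD : (0 : ℚ) < ((g - m : ℕ) : ℚ) := by
    have : 0 < g - m := by omega
    exact_mod_cast this
  have hC : (0 : ℚ) < (g.choose 2 : ℚ) := by
    have : 0 < g.choose 2 := Nat.choose_pos hg
    exact_mod_cast this
  have hQ : ((m.choose 2 : ℤ) * (3 * base4N g p + 18 * (xiCrude g p : ℤ)) * ((g - m : ℕ) : ℤ) * (g.choose 2 : ℤ) : ℚ) ≤
      ((p.choose 2 : ℤ) * LtermN4 g p m : ℚ) := by exact_mod_cast h
  push_cast at hQ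
  rw [LtermN4_eq hm hg] at hQ
  have hB : (base4N g p : ℚ) = 5 * base4 g p := by
    unfold base4N base4
    push_cast
    ring
  rw [hB] at hQ
  have hpos : (0 : ℚ) < 15 * ((g - m : ℕ) : ℚ) * (g.choose 2 : ℚ) := by positivity
  nlinarith [hQ, hpos]

/-- The check at a fixed `g`: `PerPairN4 g p m` for every `3 ≤ p ≤ g − 3`, `2 ≤ m < p`. -/
def perPairCheck4 (g : ℕ) : Prop :=
  ∀ p < g, ∀ m < p, (!decide (3 ≤ p ∧ p + 3 ≤ g ∧ 2 ≤ m) || decide (PerPairN4 g p m)) = true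

/-- `perPairCheck4 10` (by `decide`). -/
theorem perPairCheck4_10 : perPairCheck4 10 := by unfold perPairCheck4; decide
/-- `perPairCheck4 11` (by `decide`). -/
theorem perPairCheck4_11 : perPairCheck4 11 := by unfold perPairCheck4; decide
/-- `perPairCheck4 12` (by `decide`). -/
theorem perPairCheck4_12 : perPairCheck4 12 := by unfold perPairCheck4; decide
/-- `perPairCheck4 13` (by `decide`). -/
theorem perPairCheck4_13 : perPairCheck4 13 := by unfold perPairCheck4; decide
/-- `perPairCheck4 14` (by `decide`). -/
theorem perPairCheck4_14 : perPairCheck4 14 := by unfold perPairCheck4; decide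
/-- `perPairCheck4 15` (by `decide`). -/
theorem perPairCheck4_15 : perPairCheck4 15 := by unfold perPairCheck4; decide
/-- `perPairCheck4 16` (by `decide`). -/
theorem perPairCheck4_16 : perPairCheck4 16 := by unfold perPairCheck4; decide
/-- `perPairCheck4 17` (by `decide`). -/
theorem perPairCheck4_17 : perPairCheck4 17 := by unfold perPairCheck4; decide
/-- `perPairCheck4 18` (by `decide`). -/
theorem perPairCheck4_18 : perPairCheck4 18 := by unfold perPairCheck4; decide
/-- `perPairCheck4 19` (by `decide`). -/
theorem perPairCheck4_19 : perPairCheck4 19 := by unfold perPairCheck4; decide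
/-- `perPairCheck4 20` (by `decide`). -/
theorem perPairCheck4_20 : perPairCheck4 20 := by unfold perPairCheck4; decide
/-- `perPairCheck4 21` (by `decide`). -/
theorem perPairCheck4_21 : perPairCheck4 21 := by unfold perPairCheck4; decide
/-- `perPairCheck4 22` (by `decide`). -/
theorem perPairCheck4_22 : perPairCheck4 22 := by unfold perPairCheck4; decide
/-- `perPairCheck4 23` (by `decide`). -/
theorem perPairCheck4_23 : perPairCheck4 23 := by unfold perPairCheck4; decide
/-- `perPairCheck4 24` (by `decide`). -/
theorem perPairCheck4_24 : perPairCheck4 24 := by unfold perPairCheck4; decide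
/-- `perPairCheck4 25` (by `decide`). -/
theorem perPairCheck4_25 : perPairCheck4 25 := by unfold perPairCheck4; decide
/-- `perPairCheck4 26` (by `decide`). -/
theorem perPairCheck4_26 : perPairCheck4 26 := by unfold perPairCheck4; decide
/-- `perPairCheck4 27` (by `decide`). -/
theorem perPairCheck4_27 : perPairCheck4 27 := by unfold perPairCheck4; decide
/-- `perPairCheck4 28` (by `decide`). -/
theorem perPairCheck4_28 : perPairCheck4 28 := by unfold perPairCheck4; decide
/-- `perPairCheck4 29` (by `decide`). -/
theorem perPairCheck4_29 : perPairCheck4 29 := by unfold perPairCheck4; decide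
/-- `perPairCheck4 30` (by `decide`). -/
theorem perPairCheck4_30 : perPairCheck4 30 := by unfold perPairCheck4; decide
/-- `perPairCheck4 31` (by `decide`). -/
theorem perPairCheck4_31 : perPairCheck4 31 := by unfold perPairCheck4; decide
/-- `perPairCheck4 32` (by `decide`). -/
theorem perPairCheck4_32 : perPairCheck4 32 := by unfold perPairCheck4; decide
/-- `perPairCheck4 33` (by `decide`). -/
theorem perPairCheck4_33 : perPairCheck4 33 := by unfold perPairCheck4; decide
/-- `perPairCheck4 34` (by `decide`). -/
theorem perPairCheck4_34 : perPairCheck4 34 := by unfold perPairCheck4; decide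
/-- `perPairCheck4 35` (by `decide`). -/
theorem perPairCheck4_35 : perPairCheck4 35 := by unfold perPairCheck4; decide
/-- `perPairCheck4 36` (by `decide`). -/
theorem perPairCheck4_36 : perPairCheck4 36 := by unfold perPairCheck4; decide
/-- `perPairCheck4 37` (by `decide`). -/
theorem perPairCheck4_37 : perPairCheck4 37 := by unfold perPairCheck4; decide
/-- `perPairCheck4 38` (by `decide`). -/
theorem perPairCheck4_38 : perPairCheck4 38 := by unfold perPairCheck4; decide
/-- `perPairCheck4 39` (by `decide`). -/
theorem perPairCheck4_39 : perPairCheck4 39 := by unfold perPairCheck4; decide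
/-- `perPairCheck4 40` (by `decide`). -/
theorem perPairCheck4_40 : perPairCheck4 40 := by unfold perPairCheck4; decide
/-- `perPairCheck4 41` (by `decide`). -/
theorem perPairCheck4_41 : perPairCheck4 41 := by unfold perPairCheck4; decide
/-- `perPairCheck4 42` (by `decide`). -/
theorem perPairCheck4_42 : perPairCheck4 42 := by unfold perPairCheck4; decide
/-- `perPairCheck4 43` (by `decide`). -/
theorem perPairCheck4_43 : perPairCheck4 43 := by unfold perPairCheck4; decide
/-- `perPairCheck4 44` (by `decide`). -/
theorem perPairCheck4_44 : perPairCheck4 44 := by unfold perPairCheck4; decide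
/-- `perPairCheck4 45` (by `decide`). -/
theorem perPairCheck4_45 : perPairCheck4 45 := by unfold perPairCheck4; decide
/-- `perPairCheck4 46` (by `decide`). -/
theorem perPairCheck4_46 : perPairCheck4 46 := by unfold perPairCheck4; decide
/-- `perPairCheck4 47` (by `decide`). -/
theorem perPairCheck4_47 : perPairCheck4 47 := by unfold perPairCheck4; decide
/-- `perPairCheck4 48` (by `decide`). -/
theorem perPairCheck4_48 : perPairCheck4 48 := by unfold perPairCheck4; decide
/-- `perPairCheck4 49` (by `decide`). -/
theorem perPairCheck4_49 : perPairCheck4 49 := by unfold perPairCheck4; decide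
/-- `perPairCheck4 50` (by `decide`). -/
theorem perPairCheck4_50 : perPairCheck4 50 := by unfold perPairCheck4; decide
/-- `perPairCheck4 51` (by `decide`). -/
theorem perPairCheck4_51 : perPairCheck4 51 := by unfold perPairCheck4; decide
/-- `perPairCheck4 52` (by `decide`). -/
theorem perPairCheck4_52 : perPairCheck4 52 := by unfold perPairCheck4; decide
/-- `perPairCheck4 53` (by `decide`). -/
theorem perPairCheck4_53 : perPairCheck4 53 := by unfold perPairCheck4; decide
/-- `perPairCheck4 54` (by `decide`). -/
theorem perPairCheck4_54 : perPairCheck4 54 := by unfold perPairCheck4; decide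
/-- `perPairCheck4 55` (by `decide`). -/
theorem perPairCheck4_55 : perPairCheck4 55 := by unfold perPairCheck4; decide
/-- `perPairCheck4 56` (by `decide`). -/
theorem perPairCheck4_56 : perPairCheck4 56 := by unfold perPairCheck4; decide
/-- `perPairCheck4 57` (by `decide`). -/
theorem perPairCheck4_57 : perPairCheck4 57 := by unfold perPairCheck4; decide
/-- `perPairCheck4 58` (by `decide`). -/
theorem perPairCheck4_58 : perPairCheck4 58 := by unfold perPairCheck4; decide
/-- `perPairCheck4 59` (by `decide`). -/
theorem perPairCheck4_59 : perPairCheck4 59 := by unfold perPairCheck4; decide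
/-- `perPairCheck4 60` (by `decide`). -/
theorem perPairCheck4_60 : perPairCheck4 60 := by unfold perPairCheck4; decide
-- the larger tables need a deeper recursion budget for `decide`
set_option maxRecDepth 20000

/-- `perPairCheck4 61` (by `decide`). -/
theorem perPairCheck4_61 : perPairCheck4 61 := by unfold perPairCheck4; decide
/-- `perPairCheck4 62` (by `decide`). -/
theorem perPairCheck4_62 : perPairCheck4 62 := by unfold perPairCheck4; decide
/-- `perPairCheck4 63` (by `decide`). -/
theorem perPairCheck4_63 : perPairCheck4 63 := by unfold perPairCheck4; decide
/-- `perPairCheck4 64` (by `decide`). -/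
theorem perPairCheck4_64 : perPairCheck4 64 := by unfold perPairCheck4; decide
/-- `perPairCheck4 65` (by `decide`). -/
theorem perPairCheck4_65 : perPairCheck4 65 := by unfold perPairCheck4; decide
/-- `perPairCheck4 66` (by `decide`). -/
theorem perPairCheck4_66 : perPairCheck4 66 := by unfold perPairCheck4; decide
/-- `perPairCheck4 67` (by `decide`). -/
theorem perPairCheck4_67 : perPairCheck4 67 := by unfold perPairCheck4; decide
/-- `perPairCheck4 68` (by `decide`). -/
theorem perPairCheck4_68 : perPairCheck4 68 := by unfold perPairCheck4; decide
/-- `perPairCheck4 69` (by `decide`). -/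
theorem perPairCheck4_69 : perPairCheck4 69 := by unfold perPairCheck4; decide
/-- `perPairCheck4 70` (by `decide`). -/
theorem perPairCheck4_70 : perPairCheck4 70 := by unfold perPairCheck4; decide
/-- `perPairCheck4 71` (by `decide`). -/
theorem perPairCheck4_71 : perPairCheck4 71 := by unfold perPairCheck4; decide
/-- `perPairCheck4 72` (by `decide`). -/
theorem perPairCheck4_72 : perPairCheck4 72 := by unfold perPairCheck4; decide
/-- `perPairCheck4 73` (by `decide`). -/
theorem perPairCheck4_73 : perPairCheck4 73 := by unfold perPairCheck4; decide
/-- `perPairCheck4 74` (by `decide`). -/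
theorem perPairCheck4_74 : perPairCheck4 74 := by unfold perPairCheck4; decide
/-- `perPairCheck4 75` (by `decide`). -/
theorem perPairCheck4_75 : perPairCheck4 75 := by unfold perPairCheck4; decide
/-- `perPairCheck4 76` (by `decide`). -/
theorem perPairCheck4_76 : perPairCheck4 76 := by unfold perPairCheck4; decide
/-- `perPairCheck4 77` (by `decide`). -/
theorem perPairCheck4_77 : perPairCheck4 77 := by unfold perPairCheck4; decide
/-- `perPairCheck4 78` (by `decide`). -/
theorem perPairCheck4_78 : perPairCheck4 78 := by unfold perPairCheck4; decide
/-- `perPairCheck4 79` (by `decide`). -/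
theorem perPairCheck4_79 : perPairCheck4 79 := by unfold perPairCheck4; decide
/-- `perPairCheck4 80` (by `decide`). -/
theorem perPairCheck4_80 : perPairCheck4 80 := by unfold perPairCheck4; decide
/-- `perPairCheck4 81` (by `decide`). -/
theorem perPairCheck4_81 : perPairCheck4 81 := by unfold perPairCheck4; decide
/-- `perPairCheck4 82` (by `decide`). -/
theorem perPairCheck4_82 : perPairCheck4 82 := by unfold perPairCheck4; decide
/-- `perPairCheck4 83` (by `decide`). -/
theorem perPairCheck4_83 : perPairCheck4 83 := by unfold perPairCheck4; decide
/-- `perPairCheck4 84` (by `decide`). -/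
theorem perPairCheck4_84 : perPairCheck4 84 := by unfold perPairCheck4; decide
/-- `perPairCheck4 85` (by `decide`). -/
theorem perPairCheck4_85 : perPairCheck4 85 := by unfold perPairCheck4; decide
/-- `perPairCheck4 86` (by `decide`). -/
theorem perPairCheck4_86 : perPairCheck4 86 := by unfold perPairCheck4; decide
/-- `perPairCheck4 87` (by `decide`). -/
theorem perPairCheck4_87 : perPairCheck4 87 := by unfold perPairCheck4; decide
/-- `perPairCheck4 88` (by `decide`). -/
theorem perPairCheck4_88 : perPairCheck4 88 := by unfold perPairCheck4; decide
/-- `perPairCheck4 89` (by `decide`). -/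
theorem perPairCheck4_89 : perPairCheck4 89 := by unfold perPairCheck4; decide
/-- `perPairCheck4 90` (by `decide`). -/
theorem perPairCheck4_90 : perPairCheck4 90 := by unfold perPairCheck4; decide
/-- `perPairCheck4 91` (by `decide`). -/
theorem perPairCheck4_91 : perPairCheck4 91 := by unfold perPairCheck4; decide
/-- `perPairCheck4 92` (by `decide`). -/
theorem perPairCheck4_92 : perPairCheck4 92 := by unfold perPairCheck4; decide
/-- `perPairCheck4 93` (by `decide`). -/
theorem perPairCheck4_93 : perPairCheck4 93 := by unfold perPairCheck4; decide
/-- `perPairCheck4 94` (by `decide`). -/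
theorem perPairCheck4_94 : perPairCheck4 94 := by unfold perPairCheck4; decide
/-- `perPairCheck4 95` (by `decide`). -/
theorem perPairCheck4_95 : perPairCheck4 95 := by unfold perPairCheck4; decide
/-- `perPairCheck4 96` (by `decide`). -/
theorem perPairCheck4_96 : perPairCheck4 96 := by unfold perPairCheck4; decide
/-- `perPairCheck4 97` (by `decide`). -/
theorem perPairCheck4_97 : perPairCheck4 97 := by unfold perPairCheck4; decide
/-- `perPairCheck4 98` (by `decide`). -/
theorem perPairCheck4_98 : perPairCheck4 98 := by unfold perPairCheck4; decide
/-- `perPairCheck4 99` (by `decide`). -/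
theorem perPairCheck4_99 : perPairCheck4 99 := by unfold perPairCheck4; decide
/-- `perPairCheck4 100` (by `decide`). -/
theorem perPairCheck4_100 : perPairCheck4 100 := by unfold perPairCheck4; decide

/-- `perPairCheck4 g` for every `10 ≤ g ≤ 100`. -/
theorem perPairCheck4_of_range {g : ℕ} (hg : 10 ≤ g) (hg' : g ≤ 100) : perPairCheck4 g := by
  interval_cases g
  exacts [perPairCheck4_10, perPairCheck4_11, perPairCheck4_12, perPairCheck4_13, perPairCheck4_14, perPairCheck4_15, perPairCheck4_16, perPairCheck4_17, perPairCheck4_18, perPairCheck4_19, perPairCheck4_20, perPairCheck4_21, perPairCheck4_22, perPairCheck4_23, perPairCheck4_24, perPairCheck4_25, perPairCheck4_26, perPairCheck4_27, perPairCheck4_28, perPairCheck4_29, perPairCheck4_30, perPairCheck4_31, perPairCheck4_32, perPairCheck4_33, perPairCheck4_34, perPairCheck4_35, perPairCheck4_36, perPairCheck4_37, perPairCheck4_38, perPairCheck4_39, perPairCheck4_40, perPairCheck4_41, perPairCheck4_42, perPairCheck4_43, perPairCheck4_44, perPairCheck4_45, perPairCheck4_46, perPairCheck4_47, perPairCheck4_48,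 perPairCheck4_49, perPairCheck4_50, perPairCheck4_51, perPairCheck4_52, perPairCheck4_53, perPairCheck4_54, perPairCheck4_55, perPairCheck4_56, perPairCheck4_57, perPairCheck4_58, perPairCheck4_59, perPairCheck4_60, perPairCheck4_61, perPairCheck4_62, perPairCheck4_63, perPairCheck4_64, perPairCheck4_65, perPairCheck4_66, perPairCheck4_67, perPairCheck4_68, perPairCheck4_69, perPairCheck4_70, perPairCheck4_71, perPairCheck4_72, perPairCheck4_73, perPairCheck4_74, perPairCheck4_75, perPairCheck4_76, perPairCheck4_77, perPairCheck4_78, perPairCheck4_79, perPairCheck4_80, perPairCheck4_81, perPairCheck4_82, perPairCheck4_83, perPairCheck4_84, perPairCheck4_85, perPairCheck4_86, perPairCheck4_87, perPairCheck4_88, perPairCheck4_89, perPairCheck4_90, perPairCheck4_91, perPairCheck4_92, perPairCheck4_93, perPairCheck4_94, perPairCheck4_95, perPairCheck4_96, perPairCheck4_97, perPairCheck4_98, perPairCheck4_99, perPairCheck4_100]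

/-- **The per-pair inequality for `10 ≤ g ≤ 100`**, `3 ≤ p ≤ g − 3`, `2 ≤ m < p`. -/
theorem perPair4_of_range {g p m : ℕ} (hg : 10 ≤ g) (hg' : g ≤ 100) (hp : 3 ≤ p) (hpg : p + 3 ≤ g) (hm : 2 ≤ m)
    (hmp : m < p) : PerPair4 g p m := by
  have hc := perPairCheck4_of_range hg hg' p (by omega) m hmp
  rw [Bool.or_eq_true, Bool.not_eq_true', decide_eq_false_iff_not, decide_eq_true_eq] at hc
  have hN : PerPairN4 g p m := hc.resolve_left (not_not.2 ⟨hp, hpg, hm⟩)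
  exact perPair4_of_perPairN4 (by omega) (by omega) hN

/-- **The `g ≥ 101` tail of the per-pair inequality at `t = 4`** (§21.13.3, two regimes in `c = g − p`): the one
named obligation of Theorem G beyond the table. -/
def PerPairTail4 : Prop := ∀ g, 101 ≤ g → ∀ p m, 3 ≤ p → p + 3 ≤ g → 2 ≤ m → m < p → PerPair4 g p m

open Finset ThmH

variable {α : Type*} [DecidableEq α] {M : Matroid α} [M.Finite] {G : Finset α}

/-- **Theorem G for `10 ≤ g ≤ 100`**: `0 ≤ J₄(G)` for every generic rank-`4` set `G ⊆ E` of a simple matroid with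
`10 ≤ |G| ≤ 100` points — no bound on the planes. -/
theorem J_four_nonneg_of_generic_of_table (hs : Simple M) (hG : G ⊆ gr M) (hr : M.eRk (G : Set α) = 4)
    (hgen : Generic M G) (hg : 10 ≤ G.card) (hg' : G.card ≤ 100) : 0 ≤ J M G 4 :=
  J_four_nonneg_of_generic_of_perPair hs hG hr hgen (by omega)
    (fun p m hp hpg hm hmp => perPair4_of_range hg hg' hp hpg hm hmp)

/-- **Theorem G for every `g ≥ 10` modulo the tail**: `0 ≤ J₄(G)` for every generic rank-`4` set `G ⊆ E` of a
simple matroid with at least `10` points, given `PerPairTail4`. -/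
theorem J_four_nonneg_of_generic_of_tail (htail : PerPairTail4) (hs : Simple M) (hG : G ⊆ gr M)
    (hr : M.eRk (G : Set α) = 4) (hgen : Generic M G) (hg : 10 ≤ G.card) : 0 ≤ J M G 4 := by
  by_cases h100 : G.card ≤ 100
  · exact J_four_nonneg_of_generic_of_table hs hG hr hgen hg h100
  · exact J_four_nonneg_of_generic_of_perPair hs hG hr hgen (by omega)
      (fun p m hp hpg hm hmp => htail G.card (by omega) p m hp hpg hm hmp)

/-- **Theorem G (`GenericFour`) from the tail**: `PerPairTail4 → GenericFour`. -/
theorem genericFour_of_perPairTail4 (htail : PerPairTail4) : GenericFour := by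
  intro β _ M _ G hs hG hr hgen hg
  exact J_four_nonneg_of_generic_of_tail htail hs hG hr hgen hg

/-- **The big-plane residue of Theorem G from the tail**: `PerPairTail4 → GenericFourBig`. -/
theorem genericFourBig_of_perPairTail4 (htail : PerPairTail4) : GenericFourBig :=
  genericFour_iff_big.1 (genericFour_of_perPairTail4 htail)

end PercRepro.SixFour
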